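import Literature.Computability.MetaComplexity.EFModMulUAssoc
import HarnessLib

/-!
# Associativity of uniform modular multiplication, part B: the stage and the law

Layer E/8 (uniform variant). Stage `s` of the associativity induction: from
`a ⊗ P_L(BC_s) ≡ P_L(AB) ⊗ C_s` (the outputs of `ABC_s` and `LHS_s`) derive the same for
`s + 1`, using the shift law on `LHS`, `BC`, two right-distributivity kits, the mask law, and
congruences; then the law `ModMulU.Assoc.isBlock_lines` with its base (everything is zero for
`C_0 = 0`) and conclusion `P_L(ABC_L) ≡ P_L(LHS_L)`: `a ⊗ (b ⊗ c) = (a ⊗ b) ⊗ c` bitwise.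

## Sources

* S. A. Cook, R. A. Reckhow, *The relative efficiency of propositional proof systems*,
  J. Symbolic Logic 44 (1979), §2.
* J. Krajíček, *Bounded Arithmetic, Propositional Logic, and Complexity Theory* (CUP 1995), §9.2.
-/

namespace Literature.Computability.MetaComplexity

open _root_.Computability Complexity Complexity.PropForm Netlist Cluster FregeSystem

namespace ModMulU

namespace Assoc

variable {L : ℕ} {o : Occ}

/-- `Cw` shifts. [folklore] -/
theorem Cw_succ {k i : ℕ} : Cw L o k (i + 1) = Cw L o (k + 1) i := by
  unfold Cw; simp only [show i + 1 + k = i + (k + 1) by omega]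

/-- Bit `0` of `Cw k`. [folklore] -/
theorem Cw_zero_idx {k : ℕ} (hk : k < L) : Cw L o k 0 = o.inp (2 * L + k) := by unfold Cw; rw [if_pos (by omega), Nat.zero_add]

/-- `Cw L` is the zero word. [folklore] -/
theorem Cw_L {i : ℕ} : Cw L o L i = zv L o := by unfold Cw zv; rw [if_neg (by omega)]

/-- `Cw 0` is `c`. [folklore] -/
theorem Cw_zero {i : ℕ} (hi : i < L) : Cw L o 0 i = o.inp (2 * L + i) := by unfold Cw; rw [if_pos (by omega), Nat.add_zero]

/-- Index computations of the right-distributivity kit `RD1_s`. [folklore] -/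
theorem r1_idx (hL : 0 < L) {s i : ℕ} (hi : i < L) :
    Comm.av (RD.C1 L (R1 L o s)) i = o.inp i ∧ Comm.av (RD.C2 L (R1 L o s)) i = o.inp i ∧ Comm.av (RD.C3 L (R1 L o s)) i = o.inp i ∧
    Comm.bv L (RD.C1 L (R1 L o s)) i = ((BC L o (s + 1)).Dv L (L - 1)).R L i ∧
    Comm.bv L (RD.C2 L (R1 L o s)) i = (BC L o (s + 1)).msk L (L - 1) i ∧
    Comm.bv L (RD.C3 L (R1 L o s)) i = (LD.MS L (RD.LDK L (R1 L o s))).R L i ∧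
    Comm.nv L (RD.C1 L (R1 L o s)) i = nv L o i ∧ Comm.nv L (RD.C2 L (R1 L o s)) i = nv L o i ∧ Comm.nv L (RD.C3 L (R1 L o s)) i = nv L o i ∧
    LD.x (RD.LDK L (R1 L o s)) i = ((BC L o (s + 1)).Dv L (L - 1)).R L i ∧ LD.y L (RD.LDK L (R1 L o s)) i = (BC L o (s + 1)).msk L (L - 1) i ∧
    LD.n L (RD.LDK L (R1 L o s)) i = nv L o i ∧ RD.nv L (R1 L o s) i = nv L o i := by
  obtain ⟨a1, a2, a3, a4, -⟩ := R1_inp (L := L) (o := o) (s := s) hL hi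
  obtain ⟨c1a, c1b, c1n, -⟩ := RD.C1_inp (L := L) (o := R1 L o s) hi
  obtain ⟨c2a, c2b, c2n, -⟩ := RD.C2_inp (L := L) (o := R1 L o s) hi
  obtain ⟨c3a, c3b, c3n, -⟩ := RD.C3_inp (L := L) (o := R1 L o s) hi
  obtain ⟨k1, k2, -, k4⟩ := RD.LDK_inp (L := L) (o := R1 L o s) hi
  unfold Comm.av Comm.bv Comm.nv LD.x LD.y LD.n RD.nv nv
  exact ⟨by rw [c1a, a1], by rw [c2a, a1], by rw [c3a, a1], by rw [c1b, a2], by rw [c2b, a3], c3b, by rw [c1n, a4], by rw [c2n, a4], by rw [c3n, a4],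
    by rw [k1, a2], by rw [k2, a3], by rw [k4, a4], a4⟩

/-- Index computations of the right-distributivity kit `RD2_s`. [folklore] -/
theorem r2_idx (hL : 0 < L) {s i : ℕ} (hi : i < L) :
    Comm.av (RD.C1 L (R2 L o s)) i = o.inp i ∧ Comm.av (RD.C2 L (R2 L o s)) i = o.inp i ∧ Comm.av (RD.C3 L (R2 L o s)) i = o.inp i ∧
    Comm.bv L (RD.C1 L (R2 L o s)) i = (BC L o (s + 1)).P L (L - 1) i ∧ Comm.bv L (RD.C2 L (R2 L o s)) i = (BC L o (s + 1)).P L (L - 1) i ∧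
    Comm.bv L (RD.C3 L (R2 L o s)) i = (LD.MS L (RD.LDK L (R2 L o s))).R L i ∧
    Comm.nv L (RD.C1 L (R2 L o s)) i = nv L o i ∧ Comm.nv L (RD.C2 L (R2 L o s)) i = nv L o i ∧ Comm.nv L (RD.C3 L (R2 L o s)) i = nv L o i ∧
    LD.x (RD.LDK L (R2 L o s)) i = (BC L o (s + 1)).P L (L - 1) i ∧ LD.y L (RD.LDK L (R2 L o s)) i = (BC L o (s + 1)).P L (L - 1) i ∧
    LD.n L (RD.LDK L (R2 L o s)) i = nv L o i ∧ RD.nv L (R2 L o s) i = nv L o i := by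
  obtain ⟨a1, a2, a3, a4, -⟩ := R2_inp (L := L) (o := o) (s := s) hL hi
  obtain ⟨c1a, c1b, c1n, -⟩ := RD.C1_inp (L := L) (o := R2 L o s) hi
  obtain ⟨c2a, c2b, c2n, -⟩ := RD.C2_inp (L := L) (o := R2 L o s) hi
  obtain ⟨c3a, c3b, c3n, -⟩ := RD.C3_inp (L := L) (o := R2 L o s) hi
  obtain ⟨k1, k2, -, k4⟩ := RD.LDK_inp (L := L) (o := R2 L o s) hi
  unfold Comm.av Comm.bv Comm.nv LD.x LD.y LD.n RD.nv nv
  exact ⟨by rw [c1a, a1], by rw [c2a, a1], by rw [c3a, a1], by rw [c1b, a2], by rw [c2b, a3], c3b, by rw [c1n, a4], by rw [c2n, a4], by rw [c3n, a4],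
    by rw [k1, a2], by rw [k2, a3], by rw [k4, a4], a4⟩

/-- `Comm.Bw O (L - L)` is the `b`-input word of a commutativity kit. [folklore] -/
theorem Bw_LL (O : Occ) {i : ℕ} (hi : i < L) : Comm.Bw L O (L - L) i = Comm.bv L O i := by
  rw [Nat.sub_self]; exact Comm.Bw_zero hi

namespace Stage

section Segs

variable (L : ℕ) (o : Occ) (K : PropForm ℕ) (m s : ℕ)

/-- The bit `c_{L-1-s}` (bit `0` of `C_{s+1}`). [folklore] -/
def cbit : ℕ := o.inp (2 * L + (L - s - 1))
/-- `BC_{s+1}`. [folklore] -/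
def BC' : View := BC L o (s + 1)
/-- `LHS_{s+1}`. [folklore] -/
def LHS' : View := LHS L o (s + 1)
/-- `ABC_{s+1}`. [folklore] -/
def ABC' : View := ABC L o (s + 1)
/-- The `a ⊗ ·` instances of the right-distributivity kits. [folklore] -/
def C1r1 : View := Comm.M L (RD.C1 L (R1 L o s)) L
/-- see `C1r1`. [folklore] -/
def C2r1 : View := Comm.M L (RD.C2 L (R1 L o s)) L
/-- see `C1r1`. [folklore] -/
def C3r1 : View := Comm.M L (RD.C3 L (R1 L o s)) L
/-- see `C1r1`. [folklore] -/
def C1r2 : View := Comm.M L (RD.C1 L (R2 L o s)) L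
/-- see `C1r1`. [folklore] -/
def C2r2 : View := Comm.M L (RD.C2 L (R2 L o s)) L
/-- see `C1r1`. [folklore] -/
def C3r2 : View := Comm.M L (RD.C3 L (R2 L o s)) L
/-- The sums of the right-distributivity kits. [folklore] -/
def AS1 : ModAddU.View := RD.AS L (R1 L o s)
/-- see `AS1`. [folklore] -/
def AS2 : ModAddU.View := RD.AS L (R2 L o s)

/-- The data of the mask law: `a ⊗ mk_{L-1}(BC_{s+1})` against `a ⊗ b`. [folklore] -/
def md : MaskMul.MulData :=
  ⟨L, (RD.C2 L (R1 L o s)).base + (Comm.oM L + L * LD.RT L), o.base + oAB L, Comm.av (RD.C2 L (R1 L o s)),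
    Comm.Bw L (RD.C2 L (R1 L o s)) (L - L), bv L o, Comm.nv L (RD.C2 L (R1 L o s)), cbit L o s⟩

/-- The segments of stage `s`. [folklore] -/
def segs : List (List (PropForm ℕ)) :=
  [ModAddU.AssocKit.transferLines (CmpB L o) ((BC' L o s).CA L) K L,                                    -- 0 b < n
   (BC' L o s).rangeLines L K,                                                                           -- 1
   ModAddU.AssocKit.transferLines (CmpA L o) (Comm.CmpA L (RD.C1 L (R1 L o s))) K L,                    -- 2
   ModAddU.AssocKit.transferLines (CmpA L o) (Comm.CmpA L (RD.C1 L (R2 L o s))) K L,                    -- 3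
   ModAddU.AssocKit.transferLines ((BC' L o s).CD L (L - 1)) (Comm.CmpB L (RD.C1 L (R1 L o s))) K L,    -- 4
   ModAddU.AssocKit.transferLines ((BC' L o s).CM L (L - 1)) (Comm.CmpB L (RD.C2 L (R1 L o s))) K L,    -- 5
   ModAddU.AssocKit.transferLines ((BC' L o s).CP L (L - 1)) (Comm.CmpB L (RD.C1 L (R2 L o s))) K L,    -- 6
   ModAddU.AssocKit.transferLines ((BC' L o s).CP L (L - 1)) (Comm.CmpB L (RD.C2 L (R2 L o s))) K L,    -- 7
   ModAddU.AssocKit.transferLines ((AB L o).CP L L) ((LHS L o s).CA L) K L,                              -- 8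
   ModAddU.AssocKit.transferLines ((AB L o).CP L L) ((LHS' L o s).CA L) K L,                             -- 9
   ModAddU.AssocKit.transferLines (CmpB L o) ((BC L o s).CA L) K L,                                      -- 10
   ModAddU.AssocKit.transferLines (CmpA L o) ((C2r1 L o s).CA L) K L,                                   -- 11
   ShiftMul.lines L K (LHS L o s) (LHS' L o s) (L - s) (zv L o),                                         -- 12
   ShiftMul.lines L K (BC L o s) (BC' L o s) (L - s) (zv L o),                                           -- 13
   RD.lines L (R1 L o s) K m,                                                                            -- 14
   RD.lines L (R2 L o s) K m,                                                                            -- 15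
   (md L o s).lines K,                                                                                   -- 16
   Adder.reflLines K ((List.range L).map o.inp ++ (List.range L).map (nv L o) ++ (List.range L).map (((BC' L o s).Dv L (L - 1)).R L) ++
     (List.range L).map ((BC' L o s).msk L (L - 1)) ++ (List.range L).map ((BC' L o s).P L (L - 1))),   -- 17
   (⟨(BC' L o s).Av L (L - 1), LD.MS L (RD.LDK L (R1 L o s)), L⟩ : ModAddU.PairData).leibLines K,       -- 18
   (⟨ABC' L o s, C3r1 L o s, L⟩ : PairData).lines K,                                                    -- 19
   ModAddU.MFI.transLines K ((ABC' L o s).P L L) (fun i => (AS1 L o s).R L i) L,                        -- 20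
   (⟨(BC' L o s).Dv L (L - 1), LD.MS L (RD.LDK L (R2 L o s)), L⟩ : ModAddU.PairData).leibLines K,       -- 21
   (⟨C1r1 L o s, C3r2 L o s, L⟩ : PairData).lines K,                                                    -- 22
   ModAddU.MFI.transLines K ((C1r1 L o s).P L L) (fun i => (AS2 L o s).R L i) L,                        -- 23
   (⟨C1r2 L o s, ABC L o s, L⟩ : PairData).lines K,                                                     -- 24
   (⟨C2r2 L o s, ABC L o s, L⟩ : PairData).lines K,                                                     -- 25
   ModAddU.MFI.transLines K ((C1r2 L o s).P L L) ((LHS L o s).P L L) L,                                 -- 26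
   ModAddU.MFI.transLines K ((C2r2 L o s).P L L) ((LHS L o s).P L L) L,                                 -- 27
   ModAddU.MFI.symmLines K ((LHS' L o s).P L (L - 1)) ((LHS L o s).P L L) L,                            -- 28
   ModAddU.MFI.transLines K ((C1r2 L o s).P L L) ((LHS' L o s).P L (L - 1)) L,                          -- 29
   ModAddU.MFI.transLines K ((C2r2 L o s).P L L) ((LHS' L o s).P L (L - 1)) L,                          -- 30
   (⟨AS2 L o s, (LHS' L o s).Dv L (L - 1), L⟩ : ModAddU.PairData).leibLines K,                          -- 31
   ModAddU.MFI.transLines K ((C1r1 L o s).P L L) (((LHS' L o s).Dv L (L - 1)).R L) L,                   -- 32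
   (List.range L).map (fun i => ctx K (eqv ((C2r1 L o s).P L L i) ((LHS' L o s).msk L (L - 1) i))),    -- 33
   (⟨AS1 L o s, (LHS' L o s).Av L (L - 1), L⟩ : ModAddU.PairData).leibLines K,                          -- 34
   ModAddU.MFI.transLines K ((ABC' L o s).P L L) (((LHS' L o s).Av L (L - 1)).R L) L]                   -- 35

end Segs

/-- The length of the segment list. [folklore] -/
theorem length_segs (L : ℕ) (o : Occ) (K : PropForm ℕ) (m s : ℕ) : (segs L o K m s).length = 36 := rfl

variable {K : PropForm ℕ} {G : FregeSystem} {T : Set (PropForm ℕ)}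

/-- **Stage `s` of the associativity law.** [cite: CookReckhow1979, §2; Krajicek1995, §9.2] -/
theorem isBlock_segs (hGC : ∀ r ∈ Comm.rules, r ∈ G.rules) (hGO : ∀ r ∈ One.rules, r ∈ G.rules) (hGS : ∀ r ∈ Sys.glue, r ∈ G.rules)
    (hGY : ∀ r ∈ Sys.sysRules, r ∈ G.rules) (hGN : ∀ r ∈ Netlist.rules, r ∈ G.rules) (hGA : ∀ r ∈ Adder.rules, r ∈ G.rules)
    (hGL : ∀ r ∈ Logic.rules, r ∈ G.rules) (hG : ∀ r ∈ ModAddU.assocRules, r ∈ G.rules) (hGM : ∀ r ∈ ModAddU.rules, r ∈ G.rules)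
    (hGR : ∀ r ∈ rangeRules, r ∈ G.rules) (hGG : ∀ r ∈ ModAddU.glueRules, r ∈ G.rules) (hGK : ∀ r ∈ LD.maskRules, r ∈ G.rules)
    (hGX : ∀ r ∈ MaskMul.rules, r ∈ G.rules)
    (hL : 0 < L) (h : AAvail L o K T) {m s : ℕ} (hm : m + 2 ≤ L) (hs : s < L)
    (hzdef : ctx K (biimp (var (zv L o)) (const false)) ∈ T)
    (hltA : ctx K (neg (var ((CmpA L o).ge L L))) ∈ T) (hltB : ctx K (neg (var ((CmpB L o).ge L L))) ∈ T)
    (hAB : ∀ χ ∈ (AB L o).rangeLines L K, χ ∈ T) (hnh : ∀ i, m ≤ i → i < L → ctx K (neg (var (nv L o i))) ∈ T)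
    (hIH : ∀ i < L, ctx K (eqv ((ABC L o s).P L L i) ((LHS L o s).P L L i)) ∈ T) :
    G.IsBlock T (segs L o K m s).flatten := by
  have hs1 : s + 1 ≤ L := hs
  have hL1 : L - 1 < L := by omega
  have hBC' : (BC' L o s).RAvail L K T := h.hBC (s + 1) hs1
  have hBC : (BC L o s).RAvail L K T := h.hBC s hs.le
  have hLHS' : (LHS' L o s).RAvail L K T := h.hLHS (s + 1) hs1
  have hLHS : (LHS L o s).RAvail L K T := h.hLHS s hs.le
  have hABC' : (ABC' L o s).RAvail L K T := h.hABC (s + 1) hs1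
  have hABC : (ABC L o s).RAvail L K T := h.hABC s hs.le
  have q1 := RD.avail_ofOcc hL (h.hR1 s hs)
  have q2 := RD.avail_ofOcc hL (h.hR2 s hs)
  have k11 := Comm.avail_ofOcc hL q1.hC1
  have k12 := Comm.avail_ofOcc hL q1.hC2
  have k13 := Comm.avail_ofOcc hL q1.hC3
  have k21 := Comm.avail_ofOcc hL q2.hC1
  have k22 := Comm.avail_ofOcc hL q2.hC2
  have k23 := Comm.avail_ofOcc hL q2.hC3
  have kL1 := LD.avail_ofOcc q1.hLDK
  have kL2 := LD.avail_ofOcc q2.hLDK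
  have eP : ∀ i, (BC' L o s).P L L i = ((BC' L o s).Av L (L - 1)).R L i := fun i => by rw [← View.P_succ, Nat.sub_add_cancel hL]
  have ecb : (BC' L o s).b (L - 1 - (L - 1)) = cbit L o s := by
    show Cw L o (L - (s + 1)) (L - 1 - (L - 1)) = o.inp (2 * L + (L - s - 1))
    have e3 : L - (s + 1) = L - s - 1 := by omega
    rw [Nat.sub_self, Cw_zero_idx (by omega), e3]
  have ecl : (LHS' L o s).b (L - 1 - (L - 1)) = cbit L o s := ecb
  refine ModAddU.AssocData.isBlock_flatten _ fun k hk => ?_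
  rw [length_segs] at hk
  have mem : ∀ {χ} (j : ℕ) (hj : j < k) (hχ : χ ∈ (segs L o K m s)[j]'(by rw [length_segs]; omega)),
      χ ∈ T ∪ {χ | ∃ j, ∃ hj : j < k, χ ∈ (segs L o K m s)[j]'(by rw [length_segs]; omega)} := fun j hj hχ => Or.inr ⟨j, hj, hχ⟩
  have hΓ : T ⊆ T ∪ {χ | ∃ j, ∃ hj : j < k, χ ∈ (segs L o K m s)[j]'(by rw [length_segs]; omega)} := fun _ hχ => Or.inl hχ
  have mr : ∀ {f : ℕ → PropForm ℕ} {W i : ℕ}, i < W → f i ∈ (List.range W).map f := fun hi => List.mem_map.2 ⟨_, List.mem_range.2 hi, rfl⟩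
  have mt : ∀ {A' A : Sub.View} (j : ℕ) (hj : j < k) (e : (segs L o K m s)[j]'(by rw [length_segs]; omega) = ModAddU.AssocKit.transferLines A' A K L),
      ctx K (neg (var (A.ge L L))) ∈ T ∪ {χ | ∃ j, ∃ hj : j < k, χ ∈ (segs L o K m s)[j]'(by rw [length_segs]; omega)} :=
    fun j hj e => mem _ hj (by rw [e]; exact ModAddU.AssocKit.mem_transferLines _ _ _ _)
  have rf : 17 < k → ∀ (w : ℕ) (z : ℕ → ℕ), (w = 0 ∧ z = o.inp ∨ w = 1 ∧ z = nv L o ∨ w = 2 ∧ z = ((BC' L o s).Dv L (L - 1)).R L ∨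
      w = 3 ∧ z = (BC' L o s).msk L (L - 1) ∨ w = 4 ∧ z = (BC' L o s).P L (L - 1)) → ∀ i < L,
      ctx K (eqv (z i) (z i)) ∈ T ∪ {χ | ∃ j, ∃ hj : j < k, χ ∈ (segs L o K m s)[j]'(by rw [length_segs]; omega)} := by
    intro hk0 w z hz i hi
    refine mem 17 hk0 (Adder.mem_reflLines ?_)
    simp only [List.mem_append, List.mem_map, List.mem_range]
    rcases hz with ⟨-, rfl⟩ | ⟨-, rfl⟩ | ⟨-, rfl⟩ | ⟨-, rfl⟩ | ⟨-, rfl⟩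
    · exact Or.inl (Or.inl (Or.inl (Or.inl ⟨i, hi, rfl⟩)))
    · exact Or.inl (Or.inl (Or.inl (Or.inr ⟨i, hi, rfl⟩)))
    · exact Or.inl (Or.inl (Or.inr ⟨i, hi, rfl⟩))
    · exact Or.inl (Or.inr ⟨i, hi, rfl⟩)
    · exact Or.inr ⟨i, hi, rfl⟩
  interval_cases k
  · -- 0: `b < n` into `BC'`
    exact ModAddU.AssocKit.isBlock_transferLines hGN hGA hGL (h.hB.mono hΓ) (hBC'.hCA.mono hΓ) (fun i hi => rfl) (fun i hi => rfl) (hΓ hltB)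
  · -- 1: the range of `BC'`
    exact View.isBlock_rangeLines hGR hGM hGA (hBC'.mono hΓ) (mt 0 (by omega) rfl)
  · exact ModAddU.AssocKit.isBlock_transferLines hGN hGA hGL (h.hA.mono hΓ) (k11.hA.mono hΓ) (fun i hi => ((r1_idx hL hi).1).symm)
      (fun i hi => ((r1_idx hL hi).2.2.2.2.2.2.1).symm) (hΓ hltA)
  · exact ModAddU.AssocKit.isBlock_transferLines hGN hGA hGL (h.hA.mono hΓ) (k21.hA.mono hΓ) (fun i hi => ((r2_idx hL hi).1).symm)
      (fun i hi => ((r2_idx hL hi).2.2.2.2.2.2.1).symm) (hΓ hltA)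
  · exact ModAddU.AssocKit.isBlock_transferLines hGN hGA hGL ((hBC'.hCD (L - 1) hL1).mono hΓ) (k11.hB.mono hΓ)
      (fun i hi => ((r1_idx hL hi).2.2.2.1).symm) (fun i hi => ((r1_idx hL hi).2.2.2.2.2.2.1).symm) (mem 1 (by omega) (View.mem_rangeLines_D hL1))
  · exact ModAddU.AssocKit.isBlock_transferLines hGN hGA hGL ((hBC'.hCM (L - 1) hL1).mono hΓ) (k12.hB.mono hΓ)
      (fun i hi => ((r1_idx hL hi).2.2.2.2.1).symm) (fun i hi => ((r1_idx hL hi).2.2.2.2.2.2.2.1).symm) (mem 1 (by omega) (View.mem_rangeLines_M hL1))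
  · exact ModAddU.AssocKit.isBlock_transferLines hGN hGA hGL ((hBC'.hCP hL1.le).mono hΓ) (k21.hB.mono hΓ)
      (fun i hi => ((r2_idx hL hi).2.2.2.1).symm) (fun i hi => ((r2_idx hL hi).2.2.2.2.2.2.1).symm) (mem 1 (by omega) (View.mem_rangeLines_P hL1.le))
  · exact ModAddU.AssocKit.isBlock_transferLines hGN hGA hGL ((hBC'.hCP hL1.le).mono hΓ) (k22.hB.mono hΓ)
      (fun i hi => ((r2_idx hL hi).2.2.2.2.1).symm) (fun i hi => ((r2_idx hL hi).2.2.2.2.2.2.2.1).symm) (mem 1 (by omega) (View.mem_rangeLines_P hL1.le))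
  · exact ModAddU.AssocKit.isBlock_transferLines hGN hGA hGL ((h.hAB.hCP le_rfl).mono hΓ) (hLHS.hCA.mono hΓ) (fun i hi => rfl) (fun i hi => rfl)
      (hΓ (hAB _ (View.mem_rangeLines_P le_rfl)))
  · exact ModAddU.AssocKit.isBlock_transferLines hGN hGA hGL ((h.hAB.hCP le_rfl).mono hΓ) (hLHS'.hCA.mono hΓ) (fun i hi => rfl) (fun i hi => rfl)
      (hΓ (hAB _ (View.mem_rangeLines_P le_rfl)))
  · exact ModAddU.AssocKit.isBlock_transferLines hGN hGA hGL (h.hB.mono hΓ) (hBC.hCA.mono hΓ) (fun i hi => rfl) (fun i hi => rfl) (hΓ hltB)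
  · exact ModAddU.AssocKit.isBlock_transferLines hGN hGA hGL (h.hA.mono hΓ) ((k12.hM L le_rfl).hCA.mono hΓ) (fun i hi => ((r1_idx hL hi).2.1).symm)
      (fun i hi => ((r1_idx hL hi).2.2.2.2.2.2.2.1).symm) (hΓ hltA)
  · -- 12: the shift law on `LHS_s`, `LHS_{s+1}`
    refine ShiftMul.isBlock_lines hGK hGN hGA hGL (hLHS.mono hΓ) (hLHS'.mono hΓ) (by omega) (by omega) (fun i hi => rfl) (fun i hi => rfl)
      (fun t ht => ?_) (fun t ht => ?_) (fun t ht1 ht2 => ?_) (hΓ hzdef) (mt 8 (by omega) rfl) (mt 9 (by omega) rfl)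
    · show Cw L o (L - s) (L - 1 - t) = zv L o; unfold Cw zv; rw [if_neg (by omega)]
    · show Cw L o (L - (s + 1)) (L - 1 - t) = zv L o; unfold Cw zv; rw [if_neg (by omega)]
    · show Cw L o (L - (s + 1)) (L - 1 - t) = Cw L o (L - s) (L - 1 - (t + 1))
      unfold Cw; simp only [show L - 1 - t + (L - (s + 1)) = L - 1 - (t + 1) + (L - s) by omega]
  · -- 13: the shift law on `BC_s`, `BC_{s+1}`
    refine ShiftMul.isBlock_lines hGK hGN hGA hGL (hBC.mono hΓ) (hBC'.mono hΓ) (by omega) (by omega) (fun i hi => rfl) (fun i hi => rfl)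
      (fun t ht => ?_) (fun t ht => ?_) (fun t ht1 ht2 => ?_) (hΓ hzdef) (mt 10 (by omega) rfl) (mt 0 (by omega) rfl)
    · show Cw L o (L - s) (L - 1 - t) = zv L o; unfold Cw zv; rw [if_neg (by omega)]
    · show Cw L o (L - (s + 1)) (L - 1 - t) = zv L o; unfold Cw zv; rw [if_neg (by omega)]
    · show Cw L o (L - (s + 1)) (L - 1 - t) = Cw L o (L - s) (L - 1 - (t + 1))
      unfold Cw; simp only [show L - 1 - t + (L - (s + 1)) = L - 1 - (t + 1) + (L - s) by omega]
  · -- 14: right distributivity `RD1_s`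
    refine RD.isBlock_lines hGC hGO hGS hGY hGN hGA hGL hG hGM hGR hGG hGK hL ⟨q1.hLDK.mono hΓ, q1.hC1.mono hΓ, q1.hC2.mono hΓ, q1.hC3.mono hΓ,
      q1.hAS.mono hΓ⟩ hm (by rw [(R1_inp hL hL).2.2.2.2]; exact hΓ hzdef) (mt 2 (by omega) rfl) (mt 4 (by omega) rfl) (mt 5 (by omega) rfl)
      fun i h₁ h₂ => ?_
    rw [(R1_inp hL h₂).2.2.2.1]; exact hΓ (hnh i h₁ h₂)
  · -- 15: right distributivity `RD2_s`
    refine RD.isBlock_lines hGC hGO hGS hGY hGN hGA hGL hG hGM hGR hGG hGK hL ⟨q2.hLDK.mono hΓ, q2.hC1.mono hΓ, q2.hC2.mono hΓ, q2.hC3.mono hΓ,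
      q2.hAS.mono hΓ⟩ hm (by rw [(R2_inp hL hL).2.2.2.2]; exact hΓ hzdef) (mt 3 (by omega) rfl) (mt 6 (by omega) rfl) (mt 7 (by omega) rfl)
      fun i h₁ h₂ => ?_
    rw [(R2_inp hL h₂).2.2.2.1]; exact hΓ (hnh i h₁ h₂)
  · -- 16: the mask law: `a ⊗ mk_{L-1}(BC') ≡ c' ∧ (a ⊗ b)`
    refine (md L o s).isBlock_lines hGX hGL ((k12.hM L le_rfl).hV.mono hΓ) ?_ ((k12.hM L le_rfl).hCA.mono hΓ) (mt 11 (by omega) rfl) fun j hj => ?_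
    · exact View.Avail.congr (h.hAB.hV.mono hΓ) rfl (fun i hi => (r1_idx hL hi).2.1) (fun i hi => rfl)
        (fun i hi => (r1_idx hL hi).2.2.2.2.2.2.2.1)
    · have := hBC'.hV.hmk (L - 1) hL1 j (show j < L from hj)
      rw [View.mkDef, ecb] at this
      show ctx K (biimp (var (Comm.Bw L (RD.C2 L (R1 L o s)) (L - L) j)) (conj (var (cbit L o s)) (var (o.inp (L + j))))) ∈ _
      rw [Bw_LL (L := L) _ (show j < L from hj), (r1_idx hL (show j < L from hj)).2.2.2.2.1]; exact hΓ this
  · -- 17: reflexivity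
    exact Adder.isBlock_reflLines hGA _ _ _
  · -- 18: `Av_{L-1}(BC') ≡ MS(LDK(RD1))`
    refine (⟨(BC' L o s).Av L (L - 1), LD.MS L (RD.LDK L (R1 L o s)), L⟩ : ModAddU.PairData).isBlock_leibLines hGN hGL ((hBC'.hV.hA _ hL1).mono hΓ)
      (kL1.hMS.mono hΓ) (fun i hi => ?_) (fun i hi => ?_) (fun i hi => ?_)
    · show ctx K (eqv (((BC' L o s).Dv L (L - 1)).R L i) (LD.x (RD.LDK L (R1 L o s)) i)) ∈ _
      rw [(r1_idx hL hi).2.2.2.2.2.2.2.2.2.1]; exact rf (by omega) 2 _ (by simp) i hi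
    · show ctx K (eqv ((BC' L o s).msk L (L - 1) i) (LD.y L (RD.LDK L (R1 L o s)) i)) ∈ _
      rw [(r1_idx hL hi).2.2.2.2.2.2.2.2.2.2.1]; exact rf (by omega) 3 _ (by simp) i hi
    · show ctx K (eqv (nv L o i) (LD.n L (RD.LDK L (R1 L o s)) i)) ∈ _
      rw [(r1_idx hL hi).2.2.2.2.2.2.2.2.2.2.2.1]; exact rf (by omega) 1 (nv L o) (by simp) i hi
  · -- 19: `ABC' ≡ a ⊗ R(x⊕y)` (`C3` of `RD1`)
    refine (⟨ABC' L o s, C3r1 L o s, L⟩ : PairData).isBlock_lines hGN hGL (hABC'.hV.mono hΓ) ((k13.hM L le_rfl).hV.mono hΓ)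
      (fun i hi => ?_) (fun i hi => ?_) (fun i hi => ?_)
    · show ctx K (eqv (o.inp i) (Comm.av (RD.C3 L (R1 L o s)) i)) ∈ _
      rw [(r1_idx hL hi).2.2.1]; exact rf (by omega) 0 o.inp (by simp) i hi
    · show ctx K (eqv ((BC' L o s).P L L i) (Comm.Bw L (RD.C3 L (R1 L o s)) (L - L) i)) ∈ _
      rw [Bw_LL _ hi, (r1_idx hL hi).2.2.2.2.2.1, eP]
      exact mem 18 (by omega) ((⟨(BC' L o s).Av L (L - 1), LD.MS L (RD.LDK L (R1 L o s)), L⟩ : ModAddU.PairData).mem_leibLines hi)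
    · show ctx K (eqv (nv L o i) (Comm.nv L (RD.C3 L (R1 L o s)) i)) ∈ _
      rw [(r1_idx hL hi).2.2.2.2.2.2.2.2.1]; exact rf (by omega) 1 (nv L o) (by simp) i hi
  · -- 20: `ABC'.out ≡ AS1.R`
    exact ModAddU.MFI.isBlock_transLines hGL K (fun i hi => mem 19 (by omega) ((⟨ABC' L o s, C3r1 L o s, L⟩ : PairData).mem_lines hi))
      (fun i hi => mem 14 (by omega) (RD.mem_lines hi))
  · -- 21: `Dv_{L-1}(BC') ≡ MS(LDK(RD2))`
    refine (⟨(BC' L o s).Dv L (L - 1), LD.MS L (RD.LDK L (R2 L o s)), L⟩ : ModAddU.PairData).isBlock_leibLines hGN hGL ((hBC'.hV.hD _ hL1).mono hΓ)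
      (kL2.hMS.mono hΓ) (fun i hi => ?_) (fun i hi => ?_) (fun i hi => ?_)
    · show ctx K (eqv ((BC' L o s).P L (L - 1) i) (LD.x (RD.LDK L (R2 L o s)) i)) ∈ _
      rw [(r2_idx hL hi).2.2.2.2.2.2.2.2.2.1]; exact rf (by omega) 4 _ (by simp) i hi
    · show ctx K (eqv ((BC' L o s).P L (L - 1) i) (LD.y L (RD.LDK L (R2 L o s)) i)) ∈ _
      rw [(r2_idx hL hi).2.2.2.2.2.2.2.2.2.2.1]; exact rf (by omega) 4 _ (by simp) i hi
    · show ctx K (eqv (nv L o i) (LD.n L (RD.LDK L (R2 L o s)) i)) ∈ _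
      rw [(r2_idx hL hi).2.2.2.2.2.2.2.2.2.2.2.1]; exact rf (by omega) 1 (nv L o) (by simp) i hi
  · -- 22: `C1(RD1) = a ⊗ R(Dv(BC')) ≡ C3(RD2) = a ⊗ R(P' ⊕ P')`
    refine (⟨C1r1 L o s, C3r2 L o s, L⟩ : PairData).isBlock_lines hGN hGL ((k11.hM L le_rfl).hV.mono hΓ) ((k23.hM L le_rfl).hV.mono hΓ)
      (fun i hi => ?_) (fun i hi => ?_) (fun i hi => ?_)
    · show ctx K (eqv (Comm.av (RD.C1 L (R1 L o s)) i) (Comm.av (RD.C3 L (R2 L o s)) i)) ∈ _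
      rw [(r1_idx hL hi).1, (r2_idx hL hi).2.2.1]; exact rf (by omega) 0 o.inp (by simp) i hi
    · show ctx K (eqv (Comm.Bw L (RD.C1 L (R1 L o s)) (L - L) i) (Comm.Bw L (RD.C3 L (R2 L o s)) (L - L) i)) ∈ _
      rw [Bw_LL _ hi, Bw_LL _ hi, (r1_idx hL hi).2.2.2.1, (r2_idx hL hi).2.2.2.2.2.1]
      exact mem 21 (by omega) ((⟨(BC' L o s).Dv L (L - 1), LD.MS L (RD.LDK L (R2 L o s)), L⟩ : ModAddU.PairData).mem_leibLines hi)
    · show ctx K (eqv (Comm.nv L (RD.C1 L (R1 L o s)) i) (Comm.nv L (RD.C3 L (R2 L o s)) i)) ∈ _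
      rw [(r1_idx hL hi).2.2.2.2.2.2.1, (r2_idx hL hi).2.2.2.2.2.2.2.2.1]; exact rf (by omega) 1 (nv L o) (by simp) i hi
  · -- 23: `C1(RD1).out ≡ AS2.R`
    exact ModAddU.MFI.isBlock_transLines hGL K (fun i hi => mem 22 (by omega) ((⟨C1r1 L o s, C3r2 L o s, L⟩ : PairData).mem_lines hi))
      (fun i hi => mem 15 (by omega) (RD.mem_lines hi))
  · -- 24: `C1(RD2) = a ⊗ P' ≡ ABC_s`
    refine (⟨C1r2 L o s, ABC L o s, L⟩ : PairData).isBlock_lines hGN hGL ((k21.hM L le_rfl).hV.mono hΓ) (hABC.hV.mono hΓ)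
      (fun i hi => ?_) (fun i hi => ?_) (fun i hi => ?_)
    · show ctx K (eqv (Comm.av (RD.C1 L (R2 L o s)) i) (o.inp i)) ∈ _
      rw [(r2_idx hL hi).1]; exact rf (by omega) 0 o.inp (by simp) i hi
    · show ctx K (eqv (Comm.Bw L (RD.C1 L (R2 L o s)) (L - L) i) ((BC L o s).P L L i)) ∈ _
      rw [Bw_LL _ hi, (r2_idx hL hi).2.2.2.1]; exact mem 13 (by omega) (ShiftMul.mem_lines (by omega) (by omega) hi)
    · show ctx K (eqv (Comm.nv L (RD.C1 L (R2 L o s)) i) (nv L o i)) ∈ _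
      rw [(r2_idx hL hi).2.2.2.2.2.2.1]; exact rf (by omega) 1 (nv L o) (by simp) i hi
  · -- 25: `C2(RD2) ≡ ABC_s`
    refine (⟨C2r2 L o s, ABC L o s, L⟩ : PairData).isBlock_lines hGN hGL ((k22.hM L le_rfl).hV.mono hΓ) (hABC.hV.mono hΓ)
      (fun i hi => ?_) (fun i hi => ?_) (fun i hi => ?_)
    · show ctx K (eqv (Comm.av (RD.C2 L (R2 L o s)) i) (o.inp i)) ∈ _
      rw [(r2_idx hL hi).2.1]; exact rf (by omega) 0 o.inp (by simp) i hi
    · show ctx K (eqv (Comm.Bw L (RD.C2 L (R2 L o s)) (L - L) i) ((BC L o s).P L L i)) ∈ _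
      rw [Bw_LL _ hi, (r2_idx hL hi).2.2.2.2.1]; exact mem 13 (by omega) (ShiftMul.mem_lines (by omega) (by omega) hi)
    · show ctx K (eqv (Comm.nv L (RD.C2 L (R2 L o s)) i) (nv L o i)) ∈ _
      rw [(r2_idx hL hi).2.2.2.2.2.2.2.1]; exact rf (by omega) 1 (nv L o) (by simp) i hi
  · -- 26: `C1(RD2).out ≡ LHS_s.out` (induction hypothesis)
    exact ModAddU.MFI.isBlock_transLines hGL K (fun i hi => mem 24 (by omega) ((⟨C1r2 L o s, ABC L o s, L⟩ : PairData).mem_lines hi))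
      (fun i hi => hΓ (hIH i hi))
  · -- 27
    exact ModAddU.MFI.isBlock_transLines hGL K (fun i hi => mem 25 (by omega) ((⟨C2r2 L o s, ABC L o s, L⟩ : PairData).mem_lines hi))
      (fun i hi => hΓ (hIH i hi))
  · -- 28: `LHS_s.out ≡ P_{L-1}(LHS')`
    exact ModAddU.MFI.isBlock_symmLines hGL K fun i hi => mem 12 (by omega) (ShiftMul.mem_lines (by omega) (by omega) hi)
  · -- 29
    exact ModAddU.MFI.isBlock_transLines hGL K (fun i hi => mem 26 (by omega) (mr hi)) (fun i hi => mem 28 (by omega) (mr hi))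
  · -- 30
    exact ModAddU.MFI.isBlock_transLines hGL K (fun i hi => mem 27 (by omega) (mr hi)) (fun i hi => mem 28 (by omega) (mr hi))
  · -- 31: `AS2 ≡ Dv_{L-1}(LHS')`
    refine (⟨AS2 L o s, (LHS' L o s).Dv L (L - 1), L⟩ : ModAddU.PairData).isBlock_leibLines hGN hGL (q2.hAS.mono hΓ) ((hLHS'.hV.hD _ hL1).mono hΓ)
      (fun i hi => mem 29 (by omega) (mr hi)) (fun i hi => mem 30 (by omega) (mr hi)) fun i hi => ?_
    show ctx K (eqv (RD.nv L (R2 L o s) i) (nv L o i)) ∈ _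
    rw [(r2_idx hL hi).2.2.2.2.2.2.2.2.2.2.2.2]; exact rf (by omega) 1 (nv L o) (by simp) i hi
  · -- 32: `C1(RD1).out ≡ R(Dv_{L-1}(LHS'))`
    exact ModAddU.MFI.isBlock_transLines hGL K (fun i hi => mem 23 (by omega) (mr hi))
      (fun i hi => mem 31 (by omega) ((⟨AS2 L o s, (LHS' L o s).Dv L (L - 1), L⟩ : ModAddU.PairData).mem_leibLines hi))
  · -- 33: `C2(RD1).out ≡ mk_{L-1}(LHS')`
    refine Scaffold.isBlock_of_forall fun θ hθ => ?_
    obtain ⟨i, hi, rfl⟩ := List.mem_map.1 hθ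
    rw [List.mem_range] at hi
    refine Or.inr (One.infer hGO 8 (by decide) (FregeSystem.sub [K, var ((C2r1 L o s).P L L i), var ((LHS' L o s).msk L (L - 1) i),
      var (cbit L o s), var ((AB L o).P L L i)]) rfl fun ψ hψ => ?_)
    simp only [One.rules, List.getElem_cons_succ, List.getElem_cons_zero, One.rMaskEqv, List.mem_cons, List.not_mem_nil, or_false] at hψ
    rcases hψ with rfl | rfl
    · exact mem 16 (by omega) ((md L o s).mem_lines (K := K) hi)
    · have := hLHS'.hV.hmk (L - 1) hL1 i hi
      rw [View.mkDef, ecl] at this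
      exact hΓ this
  · -- 34: `AS1 ≡ Av_{L-1}(LHS')`
    refine (⟨AS1 L o s, (LHS' L o s).Av L (L - 1), L⟩ : ModAddU.PairData).isBlock_leibLines hGN hGL (q1.hAS.mono hΓ) ((hLHS'.hV.hA _ hL1).mono hΓ)
      (fun i hi => mem 32 (by omega) (mr hi)) (fun i hi => mem 33 (by omega) (mr hi)) fun i hi => ?_
    show ctx K (eqv (RD.nv L (R1 L o s) i) (nv L o i)) ∈ _
    rw [(r1_idx hL hi).2.2.2.2.2.2.2.2.2.2.2.2]; exact rf (by omega) 1 (nv L o) (by simp) i hi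
  · -- 35: `ABC'.out ≡ R(Av_{L-1}(LHS')) = LHS'.out`
    exact ModAddU.MFI.isBlock_transLines hGL K (fun i hi => mem 20 (by omega) (mr hi))
      (fun i hi => mem 34 (by omega) ((⟨AS1 L o s, (LHS' L o s).Av L (L - 1), L⟩ : ModAddU.PairData).mem_leibLines hi))

/-- **The conclusion of stage `s`**: `P_L(ABC_{s+1}) ≡ P_L(LHS_{s+1})`. [folklore] -/
theorem mem_segs_out (hL : 0 < L) {m s i : ℕ} (hi : i < L) :
    ctx K (eqv ((ABC L o (s + 1)).P L L i) ((LHS L o (s + 1)).P L L i)) ∈ (segs L o K m s).flatten := by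
  have h36 : (segs L o K m s).length = 36 := rfl
  have e : (LHS L o (s + 1)).P L L i = ((LHS' L o s).Av L (L - 1)).R L i := by rw [← View.P_succ, Nat.sub_add_cancel hL]; rfl
  rw [e]
  exact List.mem_flatten.2 ⟨_, List.getElem_mem (n := 35) (by omega), List.mem_map.2 ⟨i, List.mem_range.2 hi, rfl⟩⟩

end Stage

/-! ### The law -/

variable {K : PropForm ℕ} {G : FregeSystem} {T : Set (PropForm ℕ)}

section Defs

variable (L : ℕ) (o : Occ) (K : PropForm ℕ) (m : ℕ)

/-- The prefix: `¬z`, `a < n` into `AB`, the range of `AB`. [folklore] -/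
def prefixLines : List (PropForm ℕ) :=
  [ctx K (neg (var (zv L o)))] ++ (ModAddU.AssocKit.transferLines (CmpA L o) ((AB L o).CA L) K L ++ (AB L o).rangeLines L K)

/-- The base: `LHS_0`, `BC_0`, `ABC_0` are zero. [folklore] -/
def baseSegs : List (List (PropForm ℕ)) :=
  [ModAddU.AssocKit.transferLines ((AB L o).CP L L) ((LHS L o 0).CA L) K L,
   ModAddU.AssocKit.transferLines (CmpB L o) ((BC L o 0).CA L) K L,
   ModAddU.AssocKit.transferLines (CmpA L o) ((ABC L o 0).CA L) K L,
   ShiftMul.maskF L K (LHS L o 0) L,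
   ShiftMul.maskF L K (BC L o 0) L,
   Zero.lines (LHS L o 0) L K,
   Zero.lines (BC L o 0) L K,
   ShiftMul.maskF L K (ABC L o 0) L,
   Zero.lines (ABC L o 0) L K,
   (List.range L).map (fun i => ctx K (eqv ((ABC L o 0).P L L i) ((LHS L o 0).P L L i)))]

/-- The stages below `s`. [folklore] -/
def assocUpTo : ℕ → List (PropForm ℕ)
  | 0 => (baseSegs L o K).flatten
  | s + 1 => assocUpTo s ++ (Stage.segs L o K m s).flatten

/-- **The lines of the associativity law.** [folklore] -/
def lines : List (PropForm ℕ) := prefixLines L o K ++ assocUpTo L o K m L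

end Defs

/-- **The prefix forms a block.** [cite: CookReckhow1979, §2] -/
theorem isBlock_prefix (hGR : ∀ r ∈ rangeRules, r ∈ G.rules) (hGM : ∀ r ∈ ModAddU.rules, r ∈ G.rules) (hGN : ∀ r ∈ Netlist.rules, r ∈ G.rules)
    (hGA : ∀ r ∈ Adder.rules, r ∈ G.rules) (hGL : ∀ r ∈ Logic.rules, r ∈ G.rules) {Γ : Set (PropForm ℕ)} (h : AAvail L o K Γ)
    (hzdef : ctx K (biimp (var (zv L o)) (const false)) ∈ Γ) (hltA : ctx K (neg (var ((CmpA L o).ge L L))) ∈ Γ) :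
    G.IsBlock Γ (prefixLines L o K) := by
  have hz' : G.IsBlock Γ [ctx K (neg (var (zv L o)))] := FregeSystem.IsBlock.singleton (Or.inr (Logic.infer hGL 11 (by decide)
    (FregeSystem.sub [K, var (zv L o)]) rfl (FregeSystem.prems_cons hzdef FregeSystem.prems_nil)))
  refine hz'.append ((ModAddU.AssocKit.isBlock_transferLines hGN hGA hGL (h.hA.mono Set.subset_union_left) (h.hAB.hCA.mono Set.subset_union_left)
    (fun i hi => rfl) (fun i hi => rfl) (Or.inl hltA)).append (View.isBlock_rangeLines hGR hGM hGA
    ((h.hAB.mono Set.subset_union_left).mono Set.subset_union_left) (Or.inr (ModAddU.AssocKit.mem_transferLines _ _ _ _))))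

/-- The length of the base segment list. [folklore] -/
theorem length_baseSegs (L : ℕ) (o : Occ) (K : PropForm ℕ) : (baseSegs L o K).length = 10 := rfl

/-- **The base forms a block**: `(a ⊗ b) ⊗ 0 ≡ a ⊗ (b ⊗ 0)` (all zero). [cite: CookReckhow1979, §2] -/
theorem isBlock_base (hGK : ∀ r ∈ LD.maskRules, r ∈ G.rules) (hGN : ∀ r ∈ Netlist.rules, r ∈ G.rules) (hGA : ∀ r ∈ Adder.rules, r ∈ G.rules)
    (hGL : ∀ r ∈ Logic.rules, r ∈ G.rules) (h : AAvail L o K T) (hz : ctx K (neg (var (zv L o))) ∈ T)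
    (hltA : ctx K (neg (var ((CmpA L o).ge L L))) ∈ T) (hltB : ctx K (neg (var ((CmpB L o).ge L L))) ∈ T)
    (hAB : ∀ χ ∈ (AB L o).rangeLines L K, χ ∈ T) : G.IsBlock T (baseSegs L o K).flatten := by
  have hLHS : (LHS L o 0).RAvail L K T := h.hLHS 0 (Nat.zero_le _)
  have hBC : (BC L o 0).RAvail L K T := h.hBC 0 (Nat.zero_le _)
  have hABC : (ABC L o 0).RAvail L K T := h.hABC 0 (Nat.zero_le _)
  refine ModAddU.AssocData.isBlock_flatten _ fun k hk => ?_
  rw [length_baseSegs] at hk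
  have mem : ∀ {χ} (j : ℕ) (hj : j < k) (hχ : χ ∈ (baseSegs L o K)[j]'(by rw [length_baseSegs]; omega)),
      χ ∈ T ∪ {χ | ∃ j, ∃ hj : j < k, χ ∈ (baseSegs L o K)[j]'(by rw [length_baseSegs]; omega)} := fun j hj hχ => Or.inr ⟨j, hj, hχ⟩
  have hΓ : T ⊆ T ∪ {χ | ∃ j, ∃ hj : j < k, χ ∈ (baseSegs L o K)[j]'(by rw [length_baseSegs]; omega)} := fun _ hχ => Or.inl hχ
  interval_cases k
  · exact ModAddU.AssocKit.isBlock_transferLines hGN hGA hGL ((h.hAB.hCP le_rfl).mono hΓ) (hLHS.hCA.mono hΓ) (fun i hi => rfl) (fun i hi => rfl)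
      (hΓ (hAB _ (View.mem_rangeLines_P le_rfl)))
  · exact ModAddU.AssocKit.isBlock_transferLines hGN hGA hGL (h.hB.mono hΓ) (hBC.hCA.mono hΓ) (fun i hi => rfl) (fun i hi => rfl) (hΓ hltB)
  · exact ModAddU.AssocKit.isBlock_transferLines hGN hGA hGL (h.hA.mono hΓ) (hABC.hCA.mono hΓ) (fun i hi => rfl) (fun i hi => rfl) (hΓ hltA)
  · exact ShiftMul.isBlock_maskF hGL (hLHS.hV.mono hΓ) le_rfl (fun t ht => by show Cw L o (L - 0) (L - 1 - t) = zv L o; rw [Nat.sub_zero, Cw_L]) (hΓ hz)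
  · exact ShiftMul.isBlock_maskF hGL (hBC.hV.mono hΓ) le_rfl (fun t ht => by show Cw L o (L - 0) (L - 1 - t) = zv L o; rw [Nat.sub_zero, Cw_L]) (hΓ hz)
  · exact Zero.isBlock_lines hGK hGL (hLHS.hV.mono hΓ) (hLHS.hCA.mono hΓ) (mem 0 (by omega) (ModAddU.AssocKit.mem_transferLines _ _ _ _))
      fun t ht i hi => mem 3 (by omega) (ShiftMul.mem_maskF ht hi)
  · exact Zero.isBlock_lines hGK hGL (hBC.hV.mono hΓ) (hBC.hCA.mono hΓ) (mem 1 (by omega) (ModAddU.AssocKit.mem_transferLines _ _ _ _))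
      fun t ht i hi => mem 4 (by omega) (ShiftMul.mem_maskF ht hi)
  · -- masks of `ABC_0`: its multiplier `P_L(BC_0)` is false
    exact Zero.isBlock_maskF_of_bit_all hGL (hABC.hV.mono hΓ) fun t ht => mem 6 (by omega) (Zero.mem_lines le_rfl (by omega))
  · exact Zero.isBlock_lines hGK hGL (hABC.hV.mono hΓ) (hABC.hCA.mono hΓ) (mem 2 (by omega) (ModAddU.AssocKit.mem_transferLines _ _ _ _))
      fun t ht i hi => mem 7 (by omega) (ShiftMul.mem_maskF ht hi)
  · refine Scaffold.isBlock_of_forall fun θ hθ => ?_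
    obtain ⟨i, hi, rfl⟩ := List.mem_map.1 hθ
    rw [List.mem_range] at hi
    exact Or.inr (Logic.infer hGL 10 (by decide) (FregeSystem.sub [K, var ((ABC L o 0).P L L i), var ((LHS L o 0).P L L i)]) rfl
      (FregeSystem.prems_cons (mem 8 (by omega) (Zero.mem_lines le_rfl hi)) (FregeSystem.prems_cons (mem 5 (by omega) (Zero.mem_lines le_rfl hi))
        FregeSystem.prems_nil)))

/-- The conclusion of the base. [folklore] -/
theorem mem_base {i : ℕ} (hi : i < L) : ctx K (eqv ((ABC L o 0).P L L i) ((LHS L o 0).P L L i)) ∈ (baseSegs L o K).flatten := by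
  have h10 : (baseSegs L o K).length = 10 := rfl
  exact List.mem_flatten.2 ⟨_, List.getElem_mem (n := 9) (by omega), List.mem_map.2 ⟨i, List.mem_range.2 hi, rfl⟩⟩

/-- The induction hypothesis after `s` stages. [folklore] -/
theorem mem_assocUpTo (hL : 0 < L) {m : ℕ} : ∀ {s i : ℕ}, i < L →
    ctx K (eqv ((ABC L o s).P L L i) ((LHS L o s).P L L i)) ∈ assocUpTo L o K m s
  | 0, _, hi => mem_base hi
  | _ + 1, _, hi => List.mem_append_right _ (Stage.mem_segs_out hL hi)

/-- **The stages form a block.** [cite: CookReckhow1979, §2] -/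
theorem isBlock_assocUpTo (hGC : ∀ r ∈ Comm.rules, r ∈ G.rules) (hGO : ∀ r ∈ One.rules, r ∈ G.rules) (hGS : ∀ r ∈ Sys.glue, r ∈ G.rules)
    (hGY : ∀ r ∈ Sys.sysRules, r ∈ G.rules) (hGN : ∀ r ∈ Netlist.rules, r ∈ G.rules) (hGA : ∀ r ∈ Adder.rules, r ∈ G.rules)
    (hGL : ∀ r ∈ Logic.rules, r ∈ G.rules) (hG : ∀ r ∈ ModAddU.assocRules, r ∈ G.rules) (hGM : ∀ r ∈ ModAddU.rules, r ∈ G.rules)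
    (hGR : ∀ r ∈ rangeRules, r ∈ G.rules) (hGG : ∀ r ∈ ModAddU.glueRules, r ∈ G.rules) (hGK : ∀ r ∈ LD.maskRules, r ∈ G.rules)
    (hGX : ∀ r ∈ MaskMul.rules, r ∈ G.rules) (hL : 0 < L) (h : AAvail L o K T) {m : ℕ} (hm : m + 2 ≤ L)
    (hz : ctx K (neg (var (zv L o))) ∈ T) (hzdef : ctx K (biimp (var (zv L o)) (const false)) ∈ T)
    (hltA : ctx K (neg (var ((CmpA L o).ge L L))) ∈ T) (hltB : ctx K (neg (var ((CmpB L o).ge L L))) ∈ T)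
    (hAB : ∀ χ ∈ (AB L o).rangeLines L K, χ ∈ T) (hnh : ∀ i, m ≤ i → i < L → ctx K (neg (var (nv L o i))) ∈ T) :
    ∀ s ≤ L, G.IsBlock T (assocUpTo L o K m s) := by
  intro s hs
  induction s with
  | zero => exact isBlock_base hGK hGN hGA hGL h hz hltA hltB hAB
  | succ s ih =>
    refine (ih (by omega)).append (Stage.isBlock_segs hGC hGO hGS hGY hGN hGA hGL hG hGM hGR hGG hGK hGX hL
      ⟨h.hA.mono Set.subset_union_left, h.hB.mono Set.subset_union_left, h.hAB.mono Set.subset_union_left,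
        fun s hs => (h.hBC s hs).mono Set.subset_union_left, fun s hs => (h.hLHS s hs).mono Set.subset_union_left,
        fun s hs => (h.hABC s hs).mono Set.subset_union_left, fun s hs => (h.hR1 s hs).mono Set.subset_union_left,
        fun s hs => (h.hR2 s hs).mono Set.subset_union_left⟩ hm (by omega) (Or.inl hzdef) (Or.inl hltA) (Or.inl hltB)
      (fun χ hχ => Or.inl (hAB χ hχ)) (fun i h₁ h₂ => Or.inl (hnh i h₁ h₂)) fun i hi => Or.inr (mem_assocUpTo hL hi))

/-- **Associativity of modular multiplication inside Frege**: for an available occurrence of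
the associativity kit with `a, b < n` (facts about the kit's comparators), the zero gate `z`
(`z ↔ ⊥`), `0 < L`, `m + 2 ≤ L` and the high bits of `n` false from `m` on, the lines form a
block concluding `P_L(ABC_L) ≡ P_L(LHS_L)`: `a ⊗ (b ⊗ c) = (a ⊗ b) ⊗ c` bitwise.
[cite: CookReckhow1979, §2; Krajicek1995, §9.2] -/
theorem isBlock_lines (hGC : ∀ r ∈ Comm.rules, r ∈ G.rules) (hGO : ∀ r ∈ One.rules, r ∈ G.rules) (hGS : ∀ r ∈ Sys.glue, r ∈ G.rules)
    (hGY : ∀ r ∈ Sys.sysRules, r ∈ G.rules) (hGN : ∀ r ∈ Netlist.rules, r ∈ G.rules) (hGA : ∀ r ∈ Adder.rules, r ∈ G.rules)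
    (hGL : ∀ r ∈ Logic.rules, r ∈ G.rules) (hG : ∀ r ∈ ModAddU.assocRules, r ∈ G.rules) (hGM : ∀ r ∈ ModAddU.rules, r ∈ G.rules)
    (hGR : ∀ r ∈ rangeRules, r ∈ G.rules) (hGG : ∀ r ∈ ModAddU.glueRules, r ∈ G.rules) (hGK : ∀ r ∈ LD.maskRules, r ∈ G.rules)
    (hGX : ∀ r ∈ MaskMul.rules, r ∈ G.rules) (hL : 0 < L) {Γ : Set (PropForm ℕ)} (h : AAvail L o K Γ) {m : ℕ} (hm : m + 2 ≤ L)
    (hzdef : ctx K (biimp (var (zv L o)) (const false)) ∈ Γ) (hltA : ctx K (neg (var ((CmpA L o).ge L L))) ∈ Γ)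
    (hltB : ctx K (neg (var ((CmpB L o).ge L L))) ∈ Γ) (hnh : ∀ i, m ≤ i → i < L → ctx K (neg (var (nv L o i))) ∈ Γ) :
    G.IsBlock Γ (lines L o K m) := by
  have s1 : ∀ {A B : Set (PropForm ℕ)}, A ⊆ A ∪ B := fun {_ _} => Set.subset_union_left
  refine (isBlock_prefix hGR hGM hGN hGA hGL h hzdef hltA).append (isBlock_assocUpTo hGC hGO hGS hGY hGN hGA hGL hG hGM hGR hGG hGK hGX hL
    ⟨h.hA.mono s1, h.hB.mono s1, h.hAB.mono s1, fun s hs => (h.hBC s hs).mono s1, fun s hs => (h.hLHS s hs).mono s1,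
      fun s hs => (h.hABC s hs).mono s1, fun s hs => (h.hR1 s hs).mono s1, fun s hs => (h.hR2 s hs).mono s1⟩ hm
    (Or.inr (List.mem_append_left _ (List.mem_singleton_self _))) (s1 hzdef) (s1 hltA) (s1 hltB)
    (fun χ hχ => Or.inr (List.mem_append_right _ (List.mem_append_right _ hχ))) (fun i h₁ h₂ => s1 (hnh i h₁ h₂)) L le_rfl)

/-- **The conclusion of the associativity law**: `P_L(ABC_L)ᵢ ↔ P_L(LHS_L)ᵢ`. [folklore] -/
theorem mem_lines (hL : 0 < L) {m i : ℕ} (hi : i < L) : ctx K (eqv ((ABC L o L).P L L i) ((LHS L o L).P L L i)) ∈ lines L o K m :=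
  List.mem_append_right _ (mem_assocUpTo hL hi)

/-! ### The size of the law -/

/-- **Size of a stage**: `≤ 170800 (L+1)³ (|K| + 153)`. [folklore] -/
theorem proofSize_stage (hL : 0 < L) (o : Occ) (K : PropForm ℕ) (m s : ℕ) :
    proofSize (Stage.segs L o K m s).flatten ≤ 170800 * ((L + 1) * (L + 1) * (L + 1) * (K.size + 153)) := by
  have hK := Nat.zero_le K.size
  have c3 : L + 1 ≤ (L + 1) * (L + 1) * (L + 1) := by nlinarith
  have c2 : (L + 1) * (L + 1) ≤ (L + 1) * (L + 1) * (L + 1) := by nlinarith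
  have u1 : (L + 1) * (K.size + 153) ≤ (L + 1) * (L + 1) * (L + 1) * (K.size + 153) := Nat.mul_le_mul_right _ c3
  have u2 : (L + 1) * (L + 1) * (K.size + 153) ≤ (L + 1) * (L + 1) * (L + 1) * (K.size + 153) := Nat.mul_le_mul_right _ c2
  have ht : ∀ (A B : Sub.View), proofSize (ModAddU.AssocKit.transferLines A B K L) ≤ 6 * ((L + 1) * (L + 1) * (L + 1) * (K.size + 153)) :=
    fun A B => (ModAddU.AssocKit.proofSize_transferLines A B K L).trans (by nlinarith)
  have hr : proofSize ((Stage.BC' L o s).rangeLines L K) ≤ 12 * ((L + 1) * (L + 1) * (L + 1) * (K.size + 153)) :=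
    (View.proofSize_rangeLines (V := Stage.BC' L o s) (L := L) (K := K)).trans (by nlinarith)
  have hsm : ∀ (V V' : View), proofSize (ShiftMul.lines L K V V' (L - s) (zv L o)) ≤ 56 * ((L + 1) * (L + 1) * (L + 1) * (K.size + 153)) :=
    fun V V' => (ShiftMul.proofSize_lines (L := L) (K := K) (V := V) (V' := V') (k := L - s) (zv L o) (Nat.sub_le L s)).trans (by nlinarith)
  have hd : ∀ (O : Occ), proofSize (RD.lines L O K m) ≤ 85200 * ((L + 1) * (L + 1) * (L + 1) * (K.size + 153)) :=
    fun O => (RD.proofSize_lines (L := L) hL O K m).trans (le_of_eq (by ring))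
  have hmk : proofSize ((Stage.md L o s).lines K) ≤ 19 * ((L + 1) * (L + 1) * (L + 1) * (K.size + 153)) := by
    have := (Stage.md L o s).proofSize_lines K
    have hmkL : (Stage.md L o s).L = L := rfl
    rw [hmkL] at this; exact this.trans (by nlinarith)
  have hR : proofSize (Adder.reflLines K ((List.range L).map o.inp ++ (List.range L).map (nv L o) ++ (List.range L).map (((Stage.BC' L o s).Dv L (L - 1)).R L) ++
      (List.range L).map ((Stage.BC' L o s).msk L (L - 1)) ++ (List.range L).map ((Stage.BC' L o s).P L (L - 1)))) ≤
      5 * ((L + 1) * (L + 1) * (L + 1) * (K.size + 153)) := by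
    rw [Adder.proofSize_reflLines]; simp only [List.length_append, List.length_map, List.length_range]; nlinarith
  have hP : ∀ (M₁ M₂ : ModAddU.View), proofSize ((⟨M₁, M₂, L⟩ : ModAddU.PairData).leibLines K) ≤ 8 * ((L + 1) * (L + 1) * (L + 1) * (K.size + 153)) :=
    fun M₁ M₂ => ((⟨M₁, M₂, L⟩ : ModAddU.PairData).proofSize_leibLines (K := K)).trans (by dsimp only; nlinarith)
  have hQ : ∀ (V₁ V₂ : View), proofSize ((⟨V₁, V₂, L⟩ : PairData).lines K) ≤ 18 * ((L + 1) * (L + 1) * (L + 1) * (K.size + 153)) :=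
    fun V₁ V₂ => ((⟨V₁, V₂, L⟩ : PairData).proofSize_lines (K := K)).trans (by dsimp only; nlinarith)
  have hT : ∀ (u w : ℕ → ℕ), proofSize ((List.range L).map fun i => ctx K (eqv (u i) (w i))) ≤ (L + 1) * (L + 1) * (L + 1) * (K.size + 153) :=
    fun u w => (Comm.proofSize_mapEqv K u w L).trans (by nlinarith)
  simp only [Stage.segs, List.flatten_cons, List.flatten_nil, proofSize_append, List.append_nil]
  unfold ModAddU.MFI.transLines ModAddU.MFI.symmLines
  linarith [ht (CmpB L o) ((Stage.BC' L o s).CA L), hr, ht (CmpA L o) (Comm.CmpA L (RD.C1 L (R1 L o s))), ht (CmpA L o) (Comm.CmpA L (RD.C1 L (R2 L o s))),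
    ht ((Stage.BC' L o s).CD L (L - 1)) (Comm.CmpB L (RD.C1 L (R1 L o s))), ht ((Stage.BC' L o s).CM L (L - 1)) (Comm.CmpB L (RD.C2 L (R1 L o s))),
    ht ((Stage.BC' L o s).CP L (L - 1)) (Comm.CmpB L (RD.C1 L (R2 L o s))), ht ((Stage.BC' L o s).CP L (L - 1)) (Comm.CmpB L (RD.C2 L (R2 L o s))),
    ht ((AB L o).CP L L) ((LHS L o s).CA L), ht ((AB L o).CP L L) ((Stage.LHS' L o s).CA L), ht (CmpB L o) ((BC L o s).CA L),
    ht (CmpA L o) ((Stage.C2r1 L o s).CA L), hsm (LHS L o s) (Stage.LHS' L o s), hsm (BC L o s) (Stage.BC' L o s), hd (R1 L o s), hd (R2 L o s), hmk, hR,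
    hP ((Stage.BC' L o s).Av L (L - 1)) (LD.MS L (RD.LDK L (R1 L o s))), hQ (Stage.ABC' L o s) (Stage.C3r1 L o s),
    hT ((Stage.ABC' L o s).P L L) (fun i => (Stage.AS1 L o s).R L i), hP ((Stage.BC' L o s).Dv L (L - 1)) (LD.MS L (RD.LDK L (R2 L o s))),
    hQ (Stage.C1r1 L o s) (Stage.C3r2 L o s), hT ((Stage.C1r1 L o s).P L L) (fun i => (Stage.AS2 L o s).R L i),
    hQ (Stage.C1r2 L o s) (ABC L o s), hQ (Stage.C2r2 L o s) (ABC L o s),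
    hT ((Stage.C1r2 L o s).P L L) ((LHS L o s).P L L), hT ((Stage.C2r2 L o s).P L L) ((LHS L o s).P L L),
    hT (fun i => (LHS L o s).P L L i) (fun i => (Stage.LHS' L o s).P L (L - 1) i),
    hT ((Stage.C1r2 L o s).P L L) ((Stage.LHS' L o s).P L (L - 1)), hT ((Stage.C2r2 L o s).P L L) ((Stage.LHS' L o s).P L (L - 1)),
    hP (Stage.AS2 L o s) ((Stage.LHS' L o s).Dv L (L - 1)), hT ((Stage.C1r1 L o s).P L L) (((Stage.LHS' L o s).Dv L (L - 1)).R L),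
    hT ((Stage.C2r1 L o s).P L L) ((Stage.LHS' L o s).msk L (L - 1)), hP (Stage.AS1 L o s) ((Stage.LHS' L o s).Av L (L - 1)),
    hT ((Stage.ABC' L o s).P L L) (((Stage.LHS' L o s).Av L (L - 1)).R L)]

/-- Size of the base. [folklore] -/
theorem proofSize_base (o : Occ) (K : PropForm ℕ) : proofSize (baseSegs L o K).flatten ≤ 60 * ((L + 1) * (L + 1)) * (K.size + 153) := by
  have hm : ∀ (W : View), proofSize (ShiftMul.maskF L K W L) ≤ L * L * (K.size + 3) := by
    intro W
    refine (ModAddU.Bounded.proofSize_le (B := K.size + 3) fun θ hθ => ?_).trans ?_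
    · obtain ⟨l, hl, hθ⟩ := List.mem_flatten.1 hθ
      obtain ⟨t, -, rfl⟩ := List.mem_map.1 hl
      obtain ⟨i, -, rfl⟩ := List.mem_map.1 hθ
      rw [ModAddU.size_ctx]; simp [size]
    · apply Nat.mul_le_mul_right
      simp only [ShiftMul.maskF, List.length_flatten, List.map_map]
      rw [show (List.map (List.length ∘ fun t => List.map (fun i => ctx K (neg (var (W.msk L t i)))) (List.range L)) (List.range L)) =
        (List.range L).map (fun _ => L) from List.map_congr_left fun t _ => by simp]
      simp [List.sum_replicate]
  have hz := fun (W : View) => Zero.proofSize_lines (V := W) (L := L) (K := K)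
  have ht := fun (A B : Sub.View) => ModAddU.AssocKit.proofSize_transferLines A B K L
  have he := fun (u w : ℕ → ℕ) => Comm.proofSize_mapEqv K u w L
  simp only [baseSegs, List.flatten_cons, List.flatten_nil, proofSize_append, List.append_nil]
  nlinarith [hm (LHS L o 0), hm (BC L o 0), hm (ABC L o 0), hz (LHS L o 0), hz (BC L o 0), hz (ABC L o 0),
    ht ((AB L o).CP L L) ((LHS L o 0).CA L), ht (CmpB L o) ((BC L o 0).CA L), ht (CmpA L o) ((ABC L o 0).CA L),
    he ((ABC L o 0).P L L) ((LHS L o 0).P L L), Nat.zero_le K.size, Nat.zero_le L]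

/-- **Size of the associativity law**: `≤ 171200 (L+1)⁴ (|K| + 153)`. [folklore] -/
theorem proofSize_lines (hL : 0 < L) (o : Occ) (K : PropForm ℕ) (m : ℕ) :
    proofSize (lines L o K m) ≤ 171200 * ((L + 1) * (L + 1) * (L + 1) * (L + 1)) * (K.size + 153) := by
  have hp : proofSize (prefixLines L o K) ≤ (K.size + 12) + ((5 * L + 2) * (K.size + 10) + ((L + 2) * (K.size + 10) + L * ((3 * L + 8) * (K.size + 153)))) := by
    rw [prefixLines, proofSize_append, proofSize_append]
    refine Nat.add_le_add ?_ (Nat.add_le_add (ModAddU.AssocKit.proofSize_transferLines _ _ K L) (View.proofSize_rangeLines (V := AB L o)))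
    refine (ModAddU.Bounded.proofSize_le (B := K.size + 12) (ModAddU.Bounded.singleton ?_)).trans (by simp)
    rw [ModAddU.size_ctx]; simp [size]
  have hu : ∀ s, proofSize (assocUpTo L o K m s) ≤ 60 * ((L + 1) * (L + 1)) * (K.size + 153) + s * (170800 * ((L + 1) * (L + 1) * (L + 1) * (K.size + 153))) := by
    intro s
    induction s with
    | zero => rw [assocUpTo, Nat.zero_mul, Nat.add_zero]; exact proofSize_base o K
    | succ s ih =>
      rw [assocUpTo, proofSize_append]
      calc _ ≤ 60 * ((L + 1) * (L + 1)) * (K.size + 153) + s * (170800 * ((L + 1) * (L + 1) * (L + 1) * (K.size + 153))) +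
          170800 * ((L + 1) * (L + 1) * (L + 1) * (K.size + 153)) := Nat.add_le_add ih (proofSize_stage hL o K m s)
        _ = _ := by ring
  rw [lines, proofSize_append]
  nlinarith [hp, hu L, Nat.zero_le K.size, Nat.zero_le L]

/-- **The associativity law in compositional form.** [cite: CookReckhow1979, §2; Krajicek1995, §9.2] -/
theorem yields (hGC : ∀ r ∈ Comm.rules, r ∈ G.rules) (hGO : ∀ r ∈ One.rules, r ∈ G.rules) (hGS : ∀ r ∈ Sys.glue, r ∈ G.rules)
    (hGY : ∀ r ∈ Sys.sysRules, r ∈ G.rules) (hGN : ∀ r ∈ Netlist.rules, r ∈ G.rules) (hGA : ∀ r ∈ Adder.rules, r ∈ G.rules)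
    (hGL : ∀ r ∈ Logic.rules, r ∈ G.rules) (hG : ∀ r ∈ ModAddU.assocRules, r ∈ G.rules) (hGM : ∀ r ∈ ModAddU.rules, r ∈ G.rules)
    (hGR : ∀ r ∈ rangeRules, r ∈ G.rules) (hGG : ∀ r ∈ ModAddU.glueRules, r ∈ G.rules) (hGK : ∀ r ∈ LD.maskRules, r ∈ G.rules)
    (hGX : ∀ r ∈ MaskMul.rules, r ∈ G.rules) (hL : 0 < L) {Γ : Set (PropForm ℕ)} (h : AAvail L o K Γ) {m : ℕ} (hm : m + 2 ≤ L)
    (hzdef : ctx K (biimp (var (zv L o)) (const false)) ∈ Γ) (hltA : ctx K (neg (var ((CmpA L o).ge L L))) ∈ Γ)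
    (hltB : ctx K (neg (var ((CmpB L o).ge L L))) ∈ Γ) (hnh : ∀ i, m ≤ i → i < L → ctx K (neg (var (nv L o i))) ∈ Γ) :
    G.Yields Γ (ctxSet K (eqW ((ABC L o L).P L L) ((LHS L o L).P L L) L)) (171200 * ((L + 1) * (L + 1) * (L + 1) * (L + 1)) * (K.size + 153)) := by
  refine Yields.of_isBlock (isBlock_lines hGC hGO hGS hGY hGN hGA hGL hG hGM hGR hGG hGK hGX hL h hm hzdef hltA hltB hnh) ?_
    (proofSize_lines hL o K m)
  rintro θ ⟨Lb, hLb, rfl⟩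
  obtain ⟨i, hi, rfl⟩ := List.mem_map.1 hLb
  exact mem_lines hL (List.mem_range.1 hi)

end Assoc

end ModMulU

end Literature.Computability.MetaComplexity
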